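import Literature.NumberTheory.EllipticCurves.MasserWustholzOfGaudronRemondProofs
import Literature.NumberTheory.EllipticCurves.OpenImageMazurInputsProofs
import HarnessLib

/-!
# Masser–Wüstholz 1993, Theorem (b) over `ℚ`: reduction to the two apex leaves of the tree

Topic `Literature/NumberTheory/EllipticCurves`; a proofs-only sibling (theorems only: no
definitions, no named facts) of `MasserWustholzSurjectivity` (the named fact
`masserWustholz_surjective_modEll`: D. Masser, G. Wüstholz, *Galois properties of division fields
of elliptic curves*, Bull. London Math. Soc. 25 (1993) 247–254, Theorem (b) p. 247 at `k = ℚ`,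
Faltings-height form of §2).

`MasserWustholzOfGaudronRemondProofs` proves the fact from Mazur's isogeny theorem
(`mazur_isogeny_irreducible`, Mazur 1978 Thm. 1 — the Borel case over `ℚ`, in place of the
printed Lemma 3.1) and the Gaudron–Rémond pair bound
(`GaudronRemond2023_torsionHom_ellipticPair`, Mém. SMF 176 (2023) Thm. 1.5 (1) + Thm. 1.8 — the
Cartan cases via quadratic twists over a field of degree `≤ 60`, in place of the printed
Lemma 3.2): `MasserWustholz1993.masserWustholz_surjective_modEll_of_mazur_of_gaudronRemond`.

Mazur's theorem is itself proved in the tree from its two printed inputs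
(`mazur_isogeny_irreducible_holds_of`, file `OpenImageMazurInputs`), of which Prop. 5.1 (the
classes of `k`) is DISCHARGED (`Mazur1978.prop51_exponent_classes_of_additive_holds`, file
`OpenImageMazurInputsProofs`). This file records the resulting reduction of the Masser–Wüstholz
fact to exactly the two remaining unproved named facts of the tree on which it rests:

* `Mazur1978.cor44_valuation_j_le_one` — Mazur 1978, Cor. 4.4 (the Eisenstein quotient of
  `J₀(N)`: a rational `N`-isogeny, `N = 11` or `N ≥ 17`, forces `j` integral at the odd places);
* `DiophantineGeometry.GaudronRemond2023_torsionHom_ellipticPair` — Gaudron–Rémond 2023,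
  Thm. 1.5 (1) + Thm. 1.8 at `E × E'` (the period theorem).

So `masserWustholz_surjective_modEll_holds` is, once both leaves are discharged, the one line
`masserWustholz_surjective_modEll_of_cor44_of_gaudronRemond cor44_…_holds GaudronRemond2023_…_holds`.
Pure composition of landed theorems; nothing is assumed beyond the two displayed hypotheses.

## References

* [MasserWustholzBLMS1993] D. Masser, G. Wüstholz, Bull. London Math. Soc. 25 (1993) 247–254:
  Theorem (b) p. 247, §2 p. 248, §4 pp. 250–251.
* [Mazur1978] B. Mazur, *Rational isogenies of prime degree*, Invent. Math. 44 (1978) 129–162: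
  Thm. 1, Cor. 4.4 (p. 145), Prop. 5.1.
* [GaudronRemond2023] É. Gaudron, G. Rémond, *Nouveaux théorèmes d'isogénie*, Mém. SMF 176
  (2023): Thm. 1.5 (1) (p. 13), Thm. 1.8 (p. 15).
-/

noncomputable section

namespace Literature.NumberTheory.EllipticCurves.MasserWustholz1993

open Literature.NumberTheory.DiophantineGeometry

/-- **Masser–Wüstholz 1993, Theorem (b) over `ℚ`, from the two apex leaves.** If Mazur's
Cor. 4.4 (`Mazur1978.cor44_valuation_j_le_one`: `j(E)` integral at every odd place for `E/ℚ`
with a rational `N`-isogeny, `N = 11` or `N ≥ 17`) and the Gaudron–Rémond pair bound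
(`GaudronRemond2023_torsionHom_ellipticPair`) hold, then so does the named fact
`masserWustholz_surjective_modEll` (with `c = max(163, (241 (4e)⁸ 4⁵ · 60 · 60)⁴)`, `γ = 4`).
Proof: Cor. 4.4 and the discharged Prop. 5.1-classes give Mazur's Thm. 1
(`mazur_isogeny_irreducible_holds_of … prop51_exponent_classes_of_additive_holds`), and
`masserWustholz_surjective_modEll_of_mazur_of_gaudronRemond` concludes.
[cite: MasserWustholzBLMS1993, Theorem (b) p. 247 and §4] [cite: Mazur1978, Thm. 1, Cor. 4.4, Prop. 5.1]
[cite: GaudronRemond2023, Thm. 1.5 (1) and Thm. 1.8] -/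
theorem masserWustholz_surjective_modEll_of_cor44_of_gaudronRemond
    (h44 : Mazur1978.cor44_valuation_j_le_one)
    (hGR : GaudronRemond2023_torsionHom_ellipticPair) : masserWustholz_surjective_modEll :=
  masserWustholz_surjective_modEll_of_mazur_of_gaudronRemond
    (mazur_isogeny_irreducible_holds_of h44 Mazur1978.prop51_exponent_classes_of_additive_holds)
    hGR

end Literature.NumberTheory.EllipticCurves.MasserWustholz1993

end
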